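import Summits.ValiantsHypothesis.ValiantsHypothesis.Theses.DetQP
import Summits.ValiantsHypothesis.ValiantsHypothesis.Theses.UlrichPadded
import Summits.ValiantsHypothesis.ValiantsHypothesis.Theorems.DetqpThesis.Negative.NotQPBoundedOfExp
import Summits.ValiantsHypothesis.ValiantsHypothesis.Theorems.DetqpThesis.Negative.IffPerNotVQP
import Literature.Computability.AlgebraicComplexity.DeterminantalComplexityProofs
import Summits.ValiantsHypothesis.ValiantsHypothesis.Theorems.DetQPDetqpThesisStubLinearisation
import Summits.ValiantsHypothesis.ValiantsHypothesis.Theorems.DetQPDetqpThesisStubPerLeRankPer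
import Summits.ValiantsHypothesis.ValiantsHypothesis.Theorems.DetQPDetqpThesisStubEsymmLeRankTwo
import Summits.ValiantsHypothesis.ValiantsHypothesis.Theorems.DetQPDetqpThesisChowRankDegreeFloor
import Summits.ValiantsHypothesis.ValiantsHypothesis.Theorems.DetQPDetqpThesisChowRankKvRungRankOne

/-!
# Line `chow-rank-ladder` — skeleton for crux `DetQP.DetqpThesis`
# (stmt-ValiantsHypothesis-0315; decls `DetQP.DetqpThesis` = `UlrichPadded.Target` =
# `ScaledPencil.DcPerNotQP`, literally the same term), crux-plan v1 (2026-08-17,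
# planner-cruxplan-stmt-ValiantsHypothesis-0315-chow-rank-ladder-0); skeleton v2 (lead a2,
# 2026-08-17): S1, S5, S6 LANDED and plugged (p141664, p142196, p143800), plus the degree floor
# `2n ≤ dc (P n r)` (p144789) and `dc (P n 1) = 2n` / `2 ≤ r` for any kvRung witness (p146138);
# open: S2 (the bet, load-bearing), S3/S4 (fixed-rank milestones, NOT load-bearing).

**Crux (fixed).** `X := ¬ IsQPBounded (fun n => dc (perPoly (Fin n) ℂ))` — the Extended Valiant
Hypothesis over `ℂ` in dc form (`Negative/IffPerNotVQP.lean: detqpThesis_iff_extendedValiantHypothesis`).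

**Idea (card `Cruxes/DetqpThesis/Ideas/chow-rank-ladder.md`; triage r2: pass × 2).** Restrict the
permanent to matrices of rank `≤ r`: the RANK-`r` PERMANENT
`P n r := per_n (U Vᵀ)`, `U V : n × r` matrices of fresh variables — in tree vocabulary (no new
Literature definition; the stubs below spell the term out so that they are statements over existing
declarations only):
`aeval (fun p : Fin n × Fin n => ∑ a : Fin r, X (inl (p.1,a)) * X (inr (p.2,a))) (perPoly (Fin n) ℂ)`,
a polynomial in the `2nr` variables `(Fin n × Fin r) ⊕ (Fin n × Fin r)` (`inl` = entries of `U`,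
`inr` = entries of `V`).  Two exact facts and one bet:
* LINEARISATION (`stub_linearisation`, M, provable now): `dc (P n r) ≤ (1 + r n²) · dc (per_n)` —
  substitute `x = U Vᵀ` into a size-`m` affine representation `A₀ + Σ x_ij A_ij` of `per_n` and
  linearise the bilinear entries through the block matrix `[[A₀, 𝕌], [-𝕍, 1]]`
  (`𝕌` = the `n² r` blocks `U_ia · A_ij`, `𝕍` = the blocks `V_ja · 1_m`; `Matrix.det_fromBlocks_one₂₂`).
* TOP PIN (`stub_perLeRankPer`, M, provable now; triage r2-2 (i)): `dc (per_r) ≤ dc (P n r)` for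
  `r ≤ n` (`U = [Y; e₁; …; e₁]`, `V = [e₁ × (n-r+1); e₂; …; e_r]` gives `(n-r+1)! · per_r (Y)`).
  BOTTOM PIN (`stub_esymmLeRankTwo`, M, provable now; the card's ChowProjection at `κ = (k, n-k)`,
  `u' = 1`): `dc (e_k (x₁ … x_n)) ≤ dc (P n 2)` (`U = [x | 1]`, `V = [e₁ × k; e₂ × (n-k)]` gives
  `k! (n-k)! · e_k`).  So the ladder interpolates MONOTONICALLY: `e_k ≤ P n 2 ≤ … ≤ P n r ≥ per_r`.
* THE BET `C⁺ = RankHardness` (`stub_rankHardness`, conjecture-grade, STRICTLY STRONGER THAN `X` on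
  its diagonal — see `diagonal_of_rankHardness`): there are `c = p/q > 0` and `A ≥ 2` with
  `n^{c r} ≤ dc (P n r)` for all `r ≥ 1`, `n ≥ r^A` (ℕ-form: `n^{p r} ≤ dc^q`; rational `c` is
  w.l.o.g.).  Admissible range (card §Disproof (C), triage r2-1): `c ≤ 1` is forced by `r = 1`
  (`dc (P n 1) = 2n`), `c ≤ (A-1)/A + o(1)` by the Bombieri ABP upper bound
  `dc (P n r) ≤ poly(n) · C(n+r-1, r-1)`; the unrestricted range `r ≤ n` is FALSE (Grenet +
  linearisation), whence `n ≥ r^A`.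
* TRANSFER `C⁺ → X` is PROVED here modulo `stub_linearisation` (`two_pow_le_dcPer_comp`,
  `DetqpThesis_of`): at `n = r^A`, `dc (per_n) ≥ dc (P n r)/(1 + r^{2A+1}) ≥ 2^r` for
  `r ≥ 2^{(2A+2)q}`, an exponential lower bound along the p-bounded reindexing `r ↦ r^A`, fed to
  `Negative.not_isQPBounded_of_eventually_ge` through `Negative.qpBound_comp_le` (Disproof (E')).
* FIRST RUNGS (the calibration test of `Cruxes/DetqpThesis/NOTES.md` §Calibration asks for the first
  place where the bet says something `X` does not — it is FIXED `r`, `n → ∞`, statements about a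
  `VP` polynomial in `2nr` variables): `stub_polyRung` (triage r2-2 (ii): `dc (P n r) ≥ (2nr)^{1+1/k}`
  for ONE fixed `r` — the first consequence of `C⁺` with content, far beyond the state of the art)
  and `stub_kvRung` (triage r2-1 (s1): `dc (P n r) ≥ (1 + 1/k) · 2nr` for one fixed `r` — a
  Kumar–Volk-record-type bound, arXiv:2009.02452 Thm 1 is `1.5 · #vars` for `Σ xᵢⁿ`; theorem-candidate).
  Kernel-checked below: `C⁺ ⇒ PolyRung ⇒ KvRung` (`polyRung_of_rankHardness`, `kvRung_of_polyRung`)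
  and the `e_k` route to the bottom rung (`kvRung_of_esymm_bound`).  These two stubs are MILESTONES
  of the line (consequences of the bet at fixed rank), not hypotheses of `DetqpThesis_of`; a fixed-`r`
  statement cannot be load-bearing for `X` — that is the design of the ladder, not a cut.

**Composition.** `DetqpThesis_of : DetQP.DetqpThesis` (and `Target_of : UlrichPadded.Target`, the
same term) from `stub_linearisation` + `stub_rankHardness`, sorry-free outside the stubs.

**Disproof used** (`Cruxes/DetqpThesis/Disproof.lean`, cdisprove, 53716 B; the crux has NO
hypotheses, so there is no `_false_without_` theorem and no `-- Targets` section; landed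
`Theorems/DetqpThesis/Negative/*` = variants (A)–(G)): (A) char ≠ 2 is load-bearing for the bet —
in characteristic 2 `per = det`, so `P n r = det (U Vᵀ) = 0` for `r < n` and RankHardness is false;
every statement here is over `ℂ`; (B) "a property of per not shared by det" — the det-analogue of
the object vanishes identically (`det (U Vᵀ) = 0`, `r < n`), while `stub_linearisation` holds for
`det` too and is used only as transfer; (C) growth — no stub asserts super-Grenet growth: the
diagonal `r^{A p r/q}` at `n = r^A` is `2^{O(n^{1/A} log n)} ≪ 2^n`; (D) template constants — not
touched (the composition is constant-free via (E')); (E)/(E') the composition is literally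
`not_isQPBounded_of_eventually_ge ∘ qpBound_comp_le`; (F) `X ⇔ EVH_ℂ` — RankHardness is NOT of the
form "VNP-complete family outside a qp window": its diagonal is an EXPONENTIAL affine-dc bound for
`Q_r := P (r^A) r ⊒ per_r` (strictly stronger than `X`, said so), its off-diagonal rungs concern
`VP` polynomials (`X ⇏` them); (G) base field `ℂ`, the strongest characteristic-0 instance.
Negatives index (5668, 0340, 3735, 3738): no stub is an instance of a refuted statement (none
concerns tightness at infinity, elusive candidates or uniqueness of optimal representations).
-/

noncomputable section

-- `Summit.ValiantsHypothesis.ValiantsHypothesis.…` is the tree's mandated single-conjunct layout.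
set_option linter.dupNamespace false

namespace Summit.ValiantsHypothesis.ValiantsHypothesis.Cruxes.DetqpThesis.ChowRankLadder

open MvPolynomial
open scoped BigOperators
open Literature.Computability.AlgebraicComplexity
open Summit.ValiantsHypothesis.Theorems.DetqpThesis.Negative
  (not_isQPBounded_of_eventually_ge qpBound_comp_le)

/-! ## The object (display abbreviation only — every stub spells the term out) -/

/-- The rank-`r` permanent `P n r = per_n (U Vᵀ)`: the generic `n × n` permanent with the variable
`x_{ij}` replaced by the bilinear form `Σ_a U_{ia} V_{ja}`; `U_{ia} = X (inl (i,a))`,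
`V_{ja} = X (inr (j,a))`.  For `r = 1` it is the monomial `n! · Π U_{i0} Π V_{j0}` (`dc = 2n`), for
`r = n` it projects onto `per_n`; `per (U Vᵀ) = Σ_κ (Π κ_a!) E_κ(U) E_κ(V)` (Bombieri / Chow
expansion over compositions `κ` of `n` into `r` parts; Minc 1978 §2, Barvinok 1996). -/
abbrev rankPer (n r : ℕ) : MvPolynomial ((Fin n × Fin r) ⊕ (Fin n × Fin r)) ℂ :=
  aeval (fun p : Fin n × Fin n => ∑ a : Fin r,
    (X (Sum.inl (p.1, a)) * X (Sum.inr (p.2, a)) : MvPolynomial ((Fin n × Fin r) ⊕ (Fin n × Fin r)) ℂ))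
    (perPoly (Fin n) ℂ)

/-! ### The definition computes (tiny instances, `simp`) -/

/-- `n = 1`, `r = 1`: `P 1 1 = U₀₀ V₀₀`. -/
example : rankPer 1 1 = X (Sum.inl (0, 0)) * X (Sum.inr (0, 0)) := by
  simp [rankPer, perPoly, Matrix.permanent, Matrix.mvPolynomialX]

/-- `n = 1`, `r = 2`: `P 1 2 = U₀₀ V₀₀ + U₀₁ V₀₁`. -/
example : rankPer 1 2 =
    X (Sum.inl (0, 0)) * X (Sum.inr (0, 0)) + X (Sum.inl (0, 1)) * X (Sum.inr (0, 1)) := by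
  simp [rankPer, perPoly, Matrix.permanent, Matrix.mvPolynomialX, Fin.sum_univ_two]

/-- `n = 1`, `r = 0`: the rank-`0` permanent of positive size vanishes. -/
example : rankPer 1 0 = 0 := by
  simp [rankPer, perPoly, Matrix.permanent, Matrix.mvPolynomialX]

/-! ## Registered stubs (`sorry` only here) -/

/-- **Stub 1 — LINEARISATION** (M, provable now; load-bearing in `DetqpThesis_of`).
`dc (per_n (U Vᵀ)) ≤ (1 + r n²) · dc (per_n)`: from an attained size-`m` representation
`per_n = det (A₀ + Σ_{ij} x_{ij} A_{ij})` (`hasDetRepr_determinantalComplexity_holds`), the block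
matrix `[[A₀, 𝕌], [-𝕍, 1]]` of size `m + n² r m` with `𝕌_{(i,j,a)} = U_{ia} A_{ij}`,
`𝕍_{(i,j,a)} = V_{ja} 1_m` is affine and has determinant `det (A₀ + 𝕌 𝕍) = per_n (U Vᵀ)`
(`Matrix.det_fromBlocks_one₂₂`, reindex to `Fin`).  Holds verbatim for `det` in place of `per`
(it is a transfer lemma, not the per-specific input).  Degenerate cases: `n = 0` (`P = 1`, both
sides `0`), `r = 0 < n` (`P = 0`, `dc 0 = 1 ≤ dc per_n`). -/
theorem stub_linearisation : ∀ n r : ℕ,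
    determinantalComplexity (aeval (fun p : Fin n × Fin n => ∑ a : Fin r,
      (X (Sum.inl (p.1, a)) * X (Sum.inr (p.2, a)) : MvPolynomial ((Fin n × Fin r) ⊕ (Fin n × Fin r)) ℂ))
      (perPoly (Fin n) ℂ))
    ≤ (1 + r * n ^ 2) * determinantalComplexity (perPoly (Fin n) ℂ) :=
  -- LANDED (wave 1, p141664): Theorems/DetQPDetqpThesisStubLinearisation.lean
  Summit.ValiantsHypothesis.ValiantsHypothesis.Theorems.DetQPDetqpThesis.ChowRankLinearisation.stub_linearisation

/-- **Stub 2 — THE BET `C⁺` (RankHardness; conjecture-grade, STRICTLY STRONGER than the crux on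
its diagonal `n = r^A`, see `diagonal_of_rankHardness`; load-bearing in `DetqpThesis_of`).**
Uniform polynomial-in-`n`, exponential-in-`r` hardness of the rank-`r` permanent:
`∃ c = p/q > 0, A ≥ 2, ∀ r ≥ 1, ∀ n ≥ r^A: n^{c r} ≤ dc (P n r)`, written over `ℕ` as
`n^{p r} ≤ dc^q` (rational `c` is w.l.o.g.: shrinking `c` weakens every rung).  Why it might fail:
an ABP / determinantal expression of `per` on rank-`r` matrices of size `n^{o(r)}` uniformly in
`r` (none known: exact algorithms are `n^{O(r)}`, Barvinok 1996 doi:10.1287/moor.21.1.65; the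
Bombieri ABP has width `C(n+r-1, r-1)`), or — at the diagonal — any quasi-polynomial expression of
the permanent (`¬X`).  Consistency (card, triage): `r = 1` forces `p ≤ q`; the Bombieri upper bound
forces `p/q ≤ (A-1)/A + o(1)`; `A = 1` (all `r ≤ n`) is refuted by Grenet + `stub_linearisation`;
false in characteristic 2 (`P n r = det (U Vᵀ) = 0`, `r < n`).  Small `(r, n)` are absorbed by the
choice of `p/q` small and `A` large, so no finite instance decides it. -/
theorem stub_rankHardness : ∃ p q A : ℕ, 0 < p ∧ 0 < q ∧ 2 ≤ A ∧
    ∀ r : ℕ, 1 ≤ r → ∀ n : ℕ, r ^ A ≤ n →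
      n ^ (p * r) ≤ (determinantalComplexity (aeval (fun x : Fin n × Fin n => ∑ a : Fin r,
        (X (Sum.inl (x.1, a)) * X (Sum.inr (x.2, a)) : MvPolynomial ((Fin n × Fin r) ⊕ (Fin n × Fin r)) ℂ))
        (perPoly (Fin n) ℂ))) ^ q := by
  sorry

/-- **Stub 3 — POLYNOMIAL RUNG** (open; the first consequence of `C⁺` that says something `X` does
not — triage r2-2 (ii), calibration test (2) of `Cruxes/DetqpThesis/NOTES.md`; kernel-checked
`polyRung_of_rankHardness`).  For ONE fixed rank `r` the `VP` polynomial `P n r` (in `2nr`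
variables, degree `2n`, ABP size `n^{O(r)}`) has determinantal complexity polynomially larger
than its number of variables: `dc (P n r) ≥ (2nr)^{1 + 1/k}` for all large `n`.  Why it might fail:
nothing super-linear in the number of variables is known for ANY explicit polynomial
(Kumar–Volk arXiv:2009.02452 p. 2); `r = 1` is excluded by `dc (P n 1) = 2n`, so a witness needs
`r ≥ 2`, where `dc (P n 2) ∈ [2n, O(n²)]` is open. -/
theorem stub_polyRung : ∃ r k n₀ : ℕ, 1 ≤ r ∧ 1 ≤ k ∧ ∀ n : ℕ, n₀ ≤ n →
    (2 * n * r) ^ (k + 1) ≤ (determinantalComplexity (aeval (fun x : Fin n × Fin n => ∑ a : Fin r,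
      (X (Sum.inl (x.1, a)) * X (Sum.inr (x.2, a)) : MvPolynomial ((Fin n × Fin r) ⊕ (Fin n × Fin r)) ℂ))
      (perPoly (Fin n) ℂ))) ^ k := by
  sorry

/-- **Stub 4 — KUMAR–VOLK RUNG** (open, theorem-candidate; triage r2-1 (s1): the weakest honest
form of the first non-bookkeeping statement of the line; kernel-checked `kvRung_of_polyRung`,
`kvRung_of_esymm_bound`).  For one fixed rank `r`, `dc (P n r) ≥ (1 + 1/k) · 2nr` for all large
`n` — a determinantal-complexity lower bound exceeding the NUMBER OF VARIABLES by a constant factor,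
the type of Kumar–Volk's `dc (Σᵢ xᵢⁿ) ≥ 1.5 n - 3` (arXiv:2009.02452 Thm 1; method: dimension of the
variety swept by the affine pieces of a representation, Alper–Bogart–Velasco arXiv:1505.02205).
Why it might fail: for `P n 2` (`4n` variables, degree `2n`) Mignon–Ressayre / ABV-type bounds stop
at `2n + 1 < 4n`, so even this rung needs an argument that sees more than the Hessian and the
singular locus; `dc (P n 2) = O(n)` is not excluded by anything known. -/
theorem stub_kvRung : ∃ r k n₀ : ℕ, 1 ≤ r ∧ 1 ≤ k ∧ ∀ n : ℕ, n₀ ≤ n →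
    (k + 1) * (2 * n * r) ≤ k * determinantalComplexity (aeval (fun x : Fin n × Fin n => ∑ a : Fin r,
      (X (Sum.inl (x.1, a)) * X (Sum.inr (x.2, a)) : MvPolynomial ((Fin n × Fin r) ⊕ (Fin n × Fin r)) ℂ))
      (perPoly (Fin n) ℂ)) := by
  sorry

/-- **Stub 5 — TOP PIN `per_r ≤ P n r`** (M, provable now; triage r2-2 (i); used in
`diagonal_of_rankHardness`).  For `r ≤ n`, `dc (per_r) ≤ dc (per_n (U Vᵀ))`: the substitution
`U = [Y; e₁; …; e₁]` (`Y` the generic `r × r` matrix, `n - r` rows `e₁`),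
`V = [e₁ × (n-r+1); e₂; …; e_r]` (variables and constants only, an `IsProjection`) gives
`per_n (U Vᵀ) = (n-r+1)! · per_r (Y)` (verified exactly by triage r2-2 for `(n,r) ≤ (4,3)`); then
`determinantalComplexity_le_of_isProjection_holds` and division of one row by the unit
`(n-r+1)!` (char 0).  `r = 0`: `dc (per_0) = dc 1 = 0`. -/
theorem stub_perLeRankPer : ∀ r n : ℕ, r ≤ n →
    determinantalComplexity (perPoly (Fin r) ℂ)
    ≤ determinantalComplexity (aeval (fun x : Fin n × Fin n => ∑ a : Fin r,
      (X (Sum.inl (x.1, a)) * X (Sum.inr (x.2, a)) : MvPolynomial ((Fin n × Fin r) ⊕ (Fin n × Fin r)) ℂ))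
      (perPoly (Fin n) ℂ)) :=
  -- LANDED (wave 1, p142196): Theorems/DetQPDetqpThesisStubPerLeRankPer.lean
  Summit.ValiantsHypothesis.ValiantsHypothesis.Theorems.DetQPDetqpThesis.ChowRankPerLeRankPer.stub_perLeRankPer

/-- **Stub 6 — BOTTOM PIN `e_k ≤ P n 2`** (M, provable now; the card's ChowProjection at the
composition `κ = (k, n-k)` followed by `u' = 1`; used in `kvRung_of_esymm_bound`).  For `k ≤ n`,
`dc (e_k (x₁, …, x_n)) ≤ dc (per_n (U Vᵀ))` at rank `2`: with `U = [x | 1]` (rows `(x_i, 1)`) and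
`V = [e₁ × k; e₂ × (n-k)]`, `(U Vᵀ)_{ij} = x_i` for `j < k` and `1` otherwise, so
`per_n (U Vᵀ) = k! (n-k)! · e_k (x)` (`MvPolynomial.esymm`); then projection monotonicity and
division by the unit `k! (n-k)!`.  This is the bridge through which "a super-linear dc bound for
the elementary symmetric polynomial" (the card's advertised first theorem-candidate) feeds the
rungs; `k = 0`: `dc (e_0) = dc 1 = 0`. -/
theorem stub_esymmLeRankTwo : ∀ n k : ℕ, k ≤ n →
    determinantalComplexity (MvPolynomial.esymm (Fin n) ℂ k)
    ≤ determinantalComplexity (aeval (fun x : Fin n × Fin n => ∑ a : Fin 2,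
      (X (Sum.inl (x.1, a)) * X (Sum.inr (x.2, a)) : MvPolynomial ((Fin n × Fin 2) ⊕ (Fin n × Fin 2)) ℂ))
      (perPoly (Fin n) ℂ)) :=
  -- LANDED (wave 1, p143800): Theorems/DetQPDetqpThesisStubEsymmLeRankTwo.lean
  Summit.ValiantsHypothesis.ValiantsHypothesis.Theorems.DetQPDetqpThesis.ChowRankEsymmLeRankTwo.stub_esymmLeRankTwo

/-! ## Landed floors (wave 1): the degree floor and the rank-one value

`2n ≤ dc (P n r)` for `r ≥ 1` (p144789) and `dc (P n 1) = 2n` (p146138): every rung with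
`p r ≤ q` of the bet is free, and any witness `(r, k, n₀)` of `stub_kvRung` has `r ≥ 2`. -/

/-- The degree floor, by name (landed p144789). -/
theorem degreeFloor : ∀ n r : ℕ, 1 ≤ r → 2 * n ≤ determinantalComplexity (rankPer n r) :=
  Summit.ValiantsHypothesis.ValiantsHypothesis.Theorems.DetQPDetqpThesis.ChowRankDegreeFloor.two_mul_le_dc_rankPer

/-- The rank-one value `dc (P n 1) = 2n`, by name (landed p146138). -/
theorem dc_rankPer_one : ∀ n : ℕ, determinantalComplexity (rankPer n 1) = 2 * n :=
  Summit.ValiantsHypothesis.ValiantsHypothesis.Theorems.DetQPDetqpThesis.ChowRankKvRung.dc_rankPer_one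

/-! ## The ladder, kernel-checked: `C⁺ ⇒ PolyRung ⇒ KvRung`, and the `e_k` route

(The hypotheses below are the stub statements read through the abbreviation `rankPer`; the
registered stubs are the same terms with `rankPer` unfolded, and are fed in at the end.) -/

/-- `C⁺ ⇒` the polynomial rung: with `c = p/q`, rank `r = 2q + 2` and `k = q` do
(`n^{p r} ≥ n^{2q+2} ≥ (2r)^{q+1} n^{q+1} = (2nr)^{q+1}` once `n ≥ 2r`). -/
theorem polyRung_of_rankHardness
    (h : ∃ p q A : ℕ, 0 < p ∧ 0 < q ∧ 2 ≤ A ∧ ∀ r : ℕ, 1 ≤ r → ∀ n : ℕ, r ^ A ≤ n →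
      n ^ (p * r) ≤ (determinantalComplexity (rankPer n r)) ^ q) :
    ∃ r k n₀ : ℕ, 1 ≤ r ∧ 1 ≤ k ∧ ∀ n : ℕ, n₀ ≤ n →
      (2 * n * r) ^ (k + 1) ≤ (determinantalComplexity (rankPer n r)) ^ k := by
  obtain ⟨p, q, A, hp, hq, hA, h⟩ := h
  refine ⟨2 * q + 2, q, max ((2 * q + 2) ^ A) (2 * (2 * q + 2)), by omega, hq, fun n hn => ?_⟩
  have hnA : (2 * q + 2) ^ A ≤ n := le_trans (le_max_left _ _) hn
  have hn2 : 2 * (2 * q + 2) ≤ n := le_trans (le_max_right _ _) hn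
  have hn1 : 1 ≤ n := by omega
  have key := h (2 * q + 2) (by omega) n hnA
  calc (2 * n * (2 * q + 2)) ^ (q + 1)
      = (2 * (2 * q + 2)) ^ (q + 1) * n ^ (q + 1) := by rw [← mul_pow]; ring_nf
    _ ≤ n ^ (q + 1) * n ^ (q + 1) := Nat.mul_le_mul_right _ (Nat.pow_le_pow_left hn2 _)
    _ = n ^ (1 * (2 * q + 2)) := by rw [← pow_add]; ring_nf
    _ ≤ n ^ (p * (2 * q + 2)) := Nat.pow_le_pow_right hn1 (Nat.mul_le_mul_right _ hp)
    _ ≤ _ := key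

/-- The polynomial rung `⇒` the Kumar–Volk rung (same `r`, factor `2`): if
`(2nr)^{k+1} ≤ dc^k` and `2nr ≥ 2^k` then `(2 · 2nr)^k ≤ dc^k`, so `2 · 2nr ≤ dc`. -/
theorem kvRung_of_polyRung
    (h : ∃ r k n₀ : ℕ, 1 ≤ r ∧ 1 ≤ k ∧ ∀ n : ℕ, n₀ ≤ n →
      (2 * n * r) ^ (k + 1) ≤ (determinantalComplexity (rankPer n r)) ^ k) :
    ∃ r k n₀ : ℕ, 1 ≤ r ∧ 1 ≤ k ∧ ∀ n : ℕ, n₀ ≤ n →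
      (k + 1) * (2 * n * r) ≤ k * determinantalComplexity (rankPer n r) := by
  obtain ⟨r, k, n₀, hr, hk, h⟩ := h
  refine ⟨r, 1, max n₀ (2 ^ k), hr, le_rfl, fun n hn => ?_⟩
  have hn₀ : n₀ ≤ n := le_trans (le_max_left _ _) hn
  have hnk : 2 ^ k ≤ n := le_trans (le_max_right _ _) hn
  have key := h n hn₀
  set N := 2 * n * r with hN
  set d := determinantalComplexity (rankPer n r) with hd
  have hNk : 2 ^ k ≤ N := by
    calc 2 ^ k ≤ n := hnk
      _ ≤ 2 * n * r := by nlinarith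
  have h1 : (2 * N) ^ k ≤ d ^ k := by
    calc (2 * N) ^ k = 2 ^ k * N ^ k := by rw [mul_pow]
      _ ≤ N * N ^ k := Nat.mul_le_mul_right _ hNk
      _ = N ^ (k + 1) := by rw [pow_succ]; ring
      _ ≤ d ^ k := key
  have h2 : 2 * N ≤ d := (Nat.pow_le_pow_iff_left (by omega)).1 h1
  simpa [one_mul] using h2

/-- **The `e_k` route to the bottom rung** (the card's advertised first theorem-candidate, put on
the scale of `P n 2`): a bound `dc (e_{⌊n/2⌋} (x₁ … x_n)) ≥ (1 + 1/c) · 4n` for large `n` gives the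
Kumar–Volk rung at rank `2` through (the statement of) `stub_esymmLeRankTwo`.  NOTE THE SCALE: `4n`
is the number of variables of `P n 2`, i.e. `4 ×` the number of variables of `e_{⌊n/2⌋}` — on
`e_k`'s own scale this asks for a `(4 + δ) · #vars` bound, more than a Kumar–Volk-record
`(1 + δ) · #vars` for `e_k` (arXiv:2009.02452 Thm 1 is `1.5 · #vars` for power sums). -/
theorem kvRung_of_esymm_bound
    (h6 : ∀ n k : ℕ, k ≤ n →
      determinantalComplexity (MvPolynomial.esymm (Fin n) ℂ k) ≤ determinantalComplexity (rankPer n 2))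
    (he : ∃ c n₀ : ℕ, 1 ≤ c ∧ ∀ n : ℕ, n₀ ≤ n →
      (c + 1) * (4 * n) ≤ c * determinantalComplexity (MvPolynomial.esymm (Fin n) ℂ (n / 2))) :
    ∃ r k n₀ : ℕ, 1 ≤ r ∧ 1 ≤ k ∧ ∀ n : ℕ, n₀ ≤ n →
      (k + 1) * (2 * n * r) ≤ k * determinantalComplexity (rankPer n r) := by
  obtain ⟨c, n₀, hc, he⟩ := he
  refine ⟨2, c, n₀, by norm_num, hc, fun n hn => ?_⟩
  calc (c + 1) * (2 * n * 2) = (c + 1) * (4 * n) := by ring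
    _ ≤ c * determinantalComplexity (MvPolynomial.esymm (Fin n) ℂ (n / 2)) := he n hn
    _ ≤ c * determinantalComplexity (rankPer n 2) :=
        Nat.mul_le_mul_left _ (h6 n (n / 2) (Nat.div_le_self n 2))

/-! ## The strength of the bet, kernel-checked

(1) its diagonal `n = r^A` is an EXPONENTIAL affine-dc lower bound for the explicit family
`Q_r := P (r^A) r`, which lies above `per_r` (`stub_perLeRankPer`); (2) already a FIXED-rank rung
(`r = 6q`) gives, through `stub_linearisation`, the super-quadratic milestone
`DetQP.DetqpSuperquadratic` (crux stmt-ValiantsHypothesis-0318 of route DetQP, open: every known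
engine for `dc (per_n)` saturates at `Θ(n²)`).  So the rungs of `C⁺` are free for `p r ≤ q`
(degree), `VP`-frontier statements for `q < p r ≤ 4q` (nothing new for `per_n` through
linearisation, since `dc (per_n) ≥ n²/2` is known), at least 0318-hard for `p r > 4q`, and
`X`-hard on the diagonal.  This is the honest price list of the line (triage r2-2 (a), (b)). -/

/-- Arithmetic of the diagonal: for `A ≥ 2`, `p ≥ 1` and `r ≥ 2^{(2A+2) q}`,
`((1 + r · (r^A)²) · 2^r)^q ≤ (r^A)^{p r}`. -/
theorem diag_arith {p q A r : ℕ} (hp : 1 ≤ p) (hA : 2 ≤ A) (hr : 2 ^ ((2 * A + 2) * q) ≤ r) :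
    ((1 + r * (r ^ A) ^ 2) * 2 ^ r) ^ q ≤ (r ^ A) ^ (p * r) := by
  have hr1 : 1 ≤ r := le_trans Nat.one_le_two_pow hr
  have hlt : r < 2 ^ r := Nat.lt_two_pow_self
  -- `1 + r^{2A+1} ≤ 2^{(2A+1) r}`
  have h1 : 1 + r * (r ^ A) ^ 2 ≤ 2 ^ ((2 * A + 1) * r) := by
    have e1 : r * (r ^ A) ^ 2 = r ^ (2 * A + 1) := by ring
    have e2 : 2 ^ ((2 * A + 1) * r) = (2 ^ r) ^ (2 * A + 1) := by rw [← pow_mul]; ring_nf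
    rw [e1, e2]
    have : r ^ (2 * A + 1) < (2 ^ r) ^ (2 * A + 1) := Nat.pow_lt_pow_left hlt (by omega)
    omega
  -- hence `(1 + r^{2A+1}) · 2^r ≤ 2^{(2A+2) r}` and the `q`-th power is `≤ (2^{(2A+2) q})^r ≤ r^r`
  have h2 : (1 + r * (r ^ A) ^ 2) * 2 ^ r ≤ 2 ^ ((2 * A + 2) * r) := by
    calc (1 + r * (r ^ A) ^ 2) * 2 ^ r ≤ 2 ^ ((2 * A + 1) * r) * 2 ^ r :=
          Nat.mul_le_mul_right _ h1
      _ = 2 ^ ((2 * A + 2) * r) := by rw [← pow_add]; ring_nf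
  calc ((1 + r * (r ^ A) ^ 2) * 2 ^ r) ^ q ≤ (2 ^ ((2 * A + 2) * r)) ^ q := Nat.pow_le_pow_left h2 _
    _ = (2 ^ ((2 * A + 2) * q)) ^ r := by rw [← pow_mul, ← pow_mul]; ring_nf
    _ ≤ r ^ r := Nat.pow_le_pow_left hr _
    _ = r ^ (1 * (1 * r)) := by ring_nf
    _ ≤ r ^ (A * (p * r)) := Nat.pow_le_pow_right hr1
          (Nat.mul_le_mul (by omega) (Nat.mul_le_mul_right _ hp))
    _ = (r ^ A) ^ (p * r) := by rw [pow_mul]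

/-- **(1) The diagonal of the bet**, read through the top pin: with `Q_r := P (r^A) r`,
`dc (per_r) ≤ dc (Q_r)` (statement of `stub_perLeRankPer`: `Q_r` is at least as hard as the
permanent) and `(r^A)^{p r} ≤ dc (Q_r)^q`, i.e. `dc (Q_r) ≥ 2^{(A p/q) · r log₂ r}` — an
exponential affine-dc lower bound for an explicit family above `per_r`; in particular
`2^r ≤ dc (Q_r)` for `r ≥ 2^{(2A+2) q}`.  This is the part of `C⁺` that `X` consumes and the
measure of its strength (triage r2-2 (a)): strictly more than `X` in the same model. -/
theorem diagonal_of_rankHardness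
    (hR : ∃ p q A : ℕ, 0 < p ∧ 0 < q ∧ 2 ≤ A ∧ ∀ r : ℕ, 1 ≤ r → ∀ n : ℕ, r ^ A ≤ n →
      n ^ (p * r) ≤ (determinantalComplexity (rankPer n r)) ^ q)
    (h5 : ∀ r n : ℕ, r ≤ n →
      determinantalComplexity (perPoly (Fin r) ℂ) ≤ determinantalComplexity (rankPer n r)) :
    ∃ p q A : ℕ, 0 < p ∧ 0 < q ∧ 2 ≤ A ∧ ∀ r : ℕ, 1 ≤ r →
      determinantalComplexity (perPoly (Fin r) ℂ) ≤ determinantalComplexity (rankPer (r ^ A) r) ∧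
      (r ^ A) ^ (p * r) ≤ (determinantalComplexity (rankPer (r ^ A) r)) ^ q ∧
      (2 ^ ((2 * A + 2) * q) ≤ r → 2 ^ r ≤ determinantalComplexity (rankPer (r ^ A) r)) := by
  obtain ⟨p, q, A, hp, hq, hA, h⟩ := hR
  refine ⟨p, q, A, hp, hq, hA, fun r hr => ⟨?_, h r hr (r ^ A) le_rfl, fun hbig => ?_⟩⟩
  · exact h5 r (r ^ A) (Nat.le_self_pow (by omega) r)
  · have key := h r hr (r ^ A) le_rfl
    have hd := diag_arith (r := r) hp hA hbig
    have h1 : (2 ^ r) ^ q ≤ (determinantalComplexity (rankPer (r ^ A) r)) ^ q := by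
      calc (2 ^ r) ^ q ≤ ((1 + r * (r ^ A) ^ 2) * 2 ^ r) ^ q :=
            Nat.pow_le_pow_left (Nat.le_mul_of_pos_left _ (by positivity)) _
        _ ≤ (r ^ A) ^ (p * r) := hd
        _ ≤ _ := key
    exact (Nat.pow_le_pow_iff_left (by omega)).1 h1

/-- **(2) A fixed-rank rung is already super-quadratic for `per_n`**: Linearisation + the rung
`r = 6q` of RankHardness give `n³ ≤ dc (per_n)` for `n ≥ max (r^A) (2r)`
(`n^{6pq} ≤ dc (P n r)^q ≤ ((1 + r n²) · dc (per_n))^q` and `n³ (1 + r n²) ≤ n⁶` for `n ≥ 2r`). -/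
theorem cube_le_dcPer_of_linearisation_of_rankHardness
    (hL : ∀ n r : ℕ, determinantalComplexity (rankPer n r)
      ≤ (1 + r * n ^ 2) * determinantalComplexity (perPoly (Fin n) ℂ))
    (hR : ∃ p q A : ℕ, 0 < p ∧ 0 < q ∧ 2 ≤ A ∧ ∀ r : ℕ, 1 ≤ r → ∀ n : ℕ, r ^ A ≤ n →
      n ^ (p * r) ≤ (determinantalComplexity (rankPer n r)) ^ q) :
    ∃ n₀ : ℕ, ∀ n : ℕ, n₀ ≤ n → n ^ 3 ≤ determinantalComplexity (perPoly (Fin n) ℂ) := by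
  obtain ⟨p, q, A, hp, hq, hA, h⟩ := hR
  refine ⟨max ((6 * q) ^ A) (2 * (6 * q)), fun n hn => ?_⟩
  have hnA : (6 * q) ^ A ≤ n := le_trans (le_max_left _ _) hn
  have hn2 : 2 * (6 * q) ≤ n := le_trans (le_max_right _ _) hn
  have hn1 : 1 ≤ n := by omega
  set d := determinantalComplexity (perPoly (Fin n) ℂ) with hd
  have key : n ^ (p * (6 * q)) ≤ ((1 + 6 * q * n ^ 2) * d) ^ q :=
    (h (6 * q) (by omega) n hnA).trans (Nat.pow_le_pow_left (by exact_mod_cast hL n (6 * q)) _)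
  have h1 : n ^ 3 * (1 + 6 * q * n ^ 2) ≤ n ^ 6 := by
    have : 1 + 6 * q * n ^ 2 ≤ n * n ^ 2 := by nlinarith
    calc n ^ 3 * (1 + 6 * q * n ^ 2) ≤ n ^ 3 * (n * n ^ 2) := Nat.mul_le_mul_left _ this
      _ = n ^ 6 := by ring
  have h2 : (n ^ 3 * (1 + 6 * q * n ^ 2)) ^ q ≤ ((1 + 6 * q * n ^ 2) * d) ^ q := by
    calc (n ^ 3 * (1 + 6 * q * n ^ 2)) ^ q ≤ (n ^ 6) ^ q := Nat.pow_le_pow_left h1 _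
      _ = n ^ (1 * (6 * q)) := by rw [← pow_mul]; ring_nf
      _ ≤ n ^ (p * (6 * q)) := Nat.pow_le_pow_right hn1 (Nat.mul_le_mul_right _ hp)
      _ ≤ _ := key
  have h3 : n ^ 3 * (1 + 6 * q * n ^ 2) ≤ (1 + 6 * q * n ^ 2) * d :=
    (Nat.pow_le_pow_iff_left (by omega)).1 h2
  rw [mul_comm] at h3
  exact Nat.le_of_mul_le_mul_left h3 (by positivity)

/-- Hence Linearisation + RankHardness prove the route's milestone crux
`DetQP.DetqpSuperquadratic` (stmt-ValiantsHypothesis-0318) with `ε = 1` — recorded to calibrate the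
rungs, not as a claim on 0318. -/
theorem detqpSuperquadratic_of_linearisation_of_rankHardness
    (hL : ∀ n r : ℕ, determinantalComplexity (rankPer n r)
      ≤ (1 + r * n ^ 2) * determinantalComplexity (perPoly (Fin n) ℂ))
    (hR : ∃ p q A : ℕ, 0 < p ∧ 0 < q ∧ 2 ≤ A ∧ ∀ r : ℕ, 1 ≤ r → ∀ n : ℕ, r ^ A ≤ n →
      n ^ (p * r) ≤ (determinantalComplexity (rankPer n r)) ^ q) :
    ∃ ε : ℝ, 0 < ε ∧ ∃ n₀ : ℕ, ∀ n ≥ n₀,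
      (n : ℝ) ^ (2 + ε) ≤ (determinantalComplexity (perPoly (Fin n) ℂ) : ℝ) := by
  -- (the statement of `DetQP.DetqpSuperquadratic`, unfolded so that only `DetqpSuperquadratic_of`
  -- below concludes the route item by name)
  obtain ⟨n₀, h⟩ := cube_le_dcPer_of_linearisation_of_rankHardness hL hR
  refine ⟨1, one_pos, n₀, fun n hn => ?_⟩
  have e : (2 : ℝ) + 1 = ((3 : ℕ) : ℝ) := by norm_num
  rw [e, Real.rpow_natCast]
  exact_mod_cast h n hn

/-! ## The transfer `C⁺ → X`, kernel-checked modulo `stub_linearisation` -/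

/-- **Exponential lower bound for `dc (per)` along `r ↦ r^A`** from Linearisation + RankHardness:
at `n = r^A`, `dc (per_n)^q · (1 + r n²)^q ≥ dc (P n r)^q ≥ n^{p r} ≥ ((1 + r n²) · 2^r)^q`, so
`2^r ≤ dc (per_{r^A})` for `r ≥ 2^{(2A+2) q}`. -/
theorem two_pow_le_dcPer_comp
    (hL : ∀ n r : ℕ, determinantalComplexity (rankPer n r)
      ≤ (1 + r * n ^ 2) * determinantalComplexity (perPoly (Fin n) ℂ))
    (hR : ∃ p q A : ℕ, 0 < p ∧ 0 < q ∧ 2 ≤ A ∧ ∀ r : ℕ, 1 ≤ r → ∀ n : ℕ, r ^ A ≤ n →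
      n ^ (p * r) ≤ (determinantalComplexity (rankPer n r)) ^ q) :
    ∃ A : ℕ, 2 ≤ A ∧ ∃ r₀ : ℕ, ∀ r : ℕ, r₀ ≤ r →
      2 ^ r ≤ determinantalComplexity (perPoly (Fin (r ^ A)) ℂ) := by
  obtain ⟨p, q, A, hp, hq, hA, h⟩ := hR
  refine ⟨A, hA, 2 ^ ((2 * A + 2) * q), fun r hr => ?_⟩
  have hr1 : 1 ≤ r := le_trans Nat.one_le_two_pow hr
  set n := r ^ A with hn
  set d := determinantalComplexity (perPoly (Fin n) ℂ) with hd
  have key : n ^ (p * r) ≤ ((1 + r * n ^ 2) * d) ^ q :=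
    (h r hr1 n le_rfl).trans (Nat.pow_le_pow_left (hL n r) _)
  have harith : ((1 + r * n ^ 2) * 2 ^ r) ^ q ≤ n ^ (p * r) := diag_arith hp hA hr
  have h1 : ((1 + r * n ^ 2) * 2 ^ r) ^ q ≤ ((1 + r * n ^ 2) * d) ^ q := harith.trans key
  have h2 : (1 + r * n ^ 2) * 2 ^ r ≤ (1 + r * n ^ 2) * d :=
    (Nat.pow_le_pow_iff_left (by omega)).1 h1
  exact Nat.le_of_mul_le_mul_left h2 (by positivity)

/-- (E') of the disproof file, re-derived from the landed Negative lemmas: an eventual bound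
`2^r - 1 ≤ t (p r)` along a p-bounded `p` makes `t` not quasi-polynomially bounded. -/
theorem not_isQPBounded_of_eventually_ge_comp {t p : ℕ → ℕ} (hp : IsPBounded p)
    (h : ∃ n₀, ∀ n ≥ n₀, 2 ^ n - 1 ≤ t (p n)) : ¬ IsQPBounded t := by
  rintro ⟨c, hc⟩
  obtain ⟨c', hc'⟩ := qpBound_comp_le hp c
  exact not_isQPBounded_of_eventually_ge h ⟨c', fun n => (hc (p n)).trans (hc' n)⟩

/-- **The transfer**: Linearisation and RankHardness prove the crux (its statement unfolded here, so
that `DetqpThesis_of` below is the only theorem of the file concluding `DetQP.DetqpThesis` by name). -/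
theorem detqpThesis_of_linearisation_of_rankHardness
    (hL : ∀ n r : ℕ, determinantalComplexity (rankPer n r)
      ≤ (1 + r * n ^ 2) * determinantalComplexity (perPoly (Fin n) ℂ))
    (hR : ∃ p q A : ℕ, 0 < p ∧ 0 < q ∧ 2 ≤ A ∧ ∀ r : ℕ, 1 ≤ r → ∀ n : ℕ, r ^ A ≤ n →
      n ^ (p * r) ≤ (determinantalComplexity (rankPer n r)) ^ q) :
    ¬ IsQPBounded (fun n => determinantalComplexity (perPoly (Fin n) ℂ)) := by
  obtain ⟨A, -, r₀, h⟩ := two_pow_le_dcPer_comp hL hR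
  refine not_isQPBounded_of_eventually_ge_comp (p := fun r => r ^ A) ⟨A, fun n => Nat.le_add_right _ _⟩
    ⟨r₀, fun r hr => ?_⟩
  exact (Nat.sub_le _ _).trans (h r hr)

/-! ## The skeleton theorems (the stubs fed in; `rankPer` is an `abbrev`, so the registered
signatures — spelled out — and the `rankPer` forms above are the same terms) -/

/-- Milestones of the line in order, from the bet: `C⁺ ⇒ PolyRung ⇒ KvRung`. -/
theorem kvRung_of_stub_rankHardness :
    ∃ r k n₀ : ℕ, 1 ≤ r ∧ 1 ≤ k ∧ ∀ n : ℕ, n₀ ≤ n →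
      (k + 1) * (2 * n * r) ≤ k * determinantalComplexity (rankPer n r) :=
  kvRung_of_polyRung (polyRung_of_rankHardness stub_rankHardness)

/-- The super-quadratic milestone 0318 from stubs 1 + 2 (calibration, see above). -/
theorem DetqpSuperquadratic_of :
    Summit.ValiantsHypothesis.ValiantsHypothesis.Theses.DetQP.DetqpSuperquadratic :=
  detqpSuperquadratic_of_linearisation_of_rankHardness stub_linearisation stub_rankHardness

/-- **The crux BY NAME from the stubs** (`sorry` only inside `stub_linearisation`,
`stub_rankHardness`): `DetQP.DetqpThesis` (= `UlrichPadded.Target` = `ScaledPencil.DcPerNotQP`). -/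
theorem DetqpThesis_of : Summit.ValiantsHypothesis.ValiantsHypothesis.Theses.DetQP.DetqpThesis :=
  detqpThesis_of_linearisation_of_rankHardness stub_linearisation stub_rankHardness

/-- The same term under its UlrichPadded name (payload route of this seat). -/
theorem Target_of : Summit.ValiantsHypothesis.ValiantsHypothesis.Theses.UlrichPadded.Target :=
  DetqpThesis_of

end Summit.ValiantsHypothesis.ValiantsHypothesis.Cruxes.DetqpThesis.ChowRankLadder

end
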